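import Mathlib

/-!
# The fixed-force mean-flow family of a steady 2-D carrier, to first order:
# the exact force-defect identities (solo-blind, paper §24.75, PLAN §85, kernel #126)

Setting (paper §24.75).  A steady forced 2-D Euler carrier with stream function `Ψ` and
vorticity `ω = ΔΨ` solves `{Ψ, ΔΨ} = G`, `G = curl f`, with the Jacobian bracket
`{f, g} = ∂ₓf ∂_y g − ∂_y f ∂ₓg`.  Along the summit sequence the force `f` is FIXED, so the
second running dial of the design must be a solution-side parameter: the spatial mean `m` of the
velocity.  Writing the carrier as `Ψ = −U₀ y + pt`, the naive family `Ψ − d·y` (shift the mean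
flow, keep the cellular part) changes the force at first order, by `d·∂ₓω`; the true fixed-force
family is `Ψ + d (χ − y)` where `χ` solves the mean-sector linearised equation
`L χ := {Ψ, Δχ} + {χ, ΔΨ} = −∂ₓ ΔΨ`, and then the force defect is EXACTLY quadratic,
`d² ({χ, Δχ} + ∂ₓ Δχ)` — the structure behind the measured `0.694·d²` versus `0.829·d`
(kit j295894).

The identities are pointwise differential algebra, so they are stated over an arbitrary
commutative ring `R` (think `C^∞(ℝ²)`) with two additive maps `dx dy : R →+ R` satisfying the
Leibniz rule (the partial derivatives), an element `y` with `dx y = 0`, `dy y = 1` (the height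
coordinate) and an element `d` with `dx d = dy d = 0` (the constant increment of the mean flow).
Main results: `naiveFamily_forceDefect`, `meanFlowFamily_forceDefect`,
`meanFlowFamily_forceDefect_of_solution`.
-/

namespace Summit.AnomalousDissipation.AnomalousDissipation.Theorems

variable {R : Type*} [CommRing R]

/-- The Jacobian (Poisson) bracket `{f, g} = ∂ₓf ∂_y g − ∂_y f ∂ₓg` built from two additive maps. -/
def pbracket (dx dy : R →+ R) (f g : R) : R := dx f * dy g - dy f * dx g

/-- The Laplacian `Δ f = ∂ₓ∂ₓ f + ∂_y∂_y f`. -/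
def lapl (dx dy : R →+ R) (f : R) : R := dx (dx f) + dy (dy f)

/-- The mean-sector linearised steady Euler operator at the stream function `Ψ`:
`L χ = {Ψ, Δχ} + {χ, ΔΨ}` (paper §24.4 / §24.10). -/
def meanOp (dx dy : R →+ R) (Ψ χ : R) : R :=
  pbracket dx dy Ψ (lapl dx dy χ) + pbracket dx dy χ (lapl dx dy Ψ)

/-- A Leibniz map kills `1`. -/
theorem leibniz_map_one (δ : R →+ R) (hδ : ∀ f g : R, δ (f * g) = δ f * g + f * δ g) :
    δ 1 = 0 := by
  have h := hδ 1 1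
  simp only [mul_one, one_mul] at h
  linear_combination -h

/-- The height coordinate is harmonic: `Δ y = 0`. -/
theorem lapl_height (dx dy : R →+ R) (hy : ∀ f g : R, dy (f * g) = dy f * g + f * dy g)
    (y : R) (hxy : dx y = 0) (hyy : dy y = 1) : lapl dx dy y = 0 := by
  have h1y : dy 1 = 0 := leibniz_map_one dy hy
  simp [lapl, hxy, hyy, h1y]

/-- THE NAIVE FAMILY CHANGES THE FORCE AT FIRST ORDER.  Shifting the mean flow with the cellular
part frozen, `Ψ − d·y`, gives `{Ψ − d y, Δ(Ψ − d y)} = {Ψ, ΔΨ} + d·∂ₓ ΔΨ` exactly: unless the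
carrier is a shear flow (`∂ₓ ω = 0`) this is not a fixed-force family (ATTEMPTS A238). -/
theorem naiveFamily_forceDefect (dx dy : R →+ R)
    (hx : ∀ f g : R, dx (f * g) = dx f * g + f * dx g)
    (hy : ∀ f g : R, dy (f * g) = dy f * g + f * dy g)
    (Ψ y d : R) (hxy : dx y = 0) (hyy : dy y = 1) (hxd : dx d = 0) (hyd : dy d = 0) :
    pbracket dx dy (Ψ - d * y) (lapl dx dy (Ψ - d * y))
      = pbracket dx dy Ψ (lapl dx dy Ψ) + d * dx (lapl dx dy Ψ) := by
  simp only [pbracket, lapl, map_add, map_sub, hx, hy, hxy, hyy, hxd, hyd,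
    zero_mul, mul_zero, add_zero, zero_add, mul_one, sub_zero]
  ring

/-- THE EXACT FORCE-DEFECT IDENTITY OF THE FIRST-ORDER TRUE FAMILY.  For any `Ψ, χ`:
`{Ψ + d(χ − y), Δ(Ψ + d(χ − y))} = {Ψ, ΔΨ} + d (L χ + ∂ₓ ΔΨ) + d² ({χ, Δχ} + ∂ₓ Δχ)`. -/
theorem meanFlowFamily_forceDefect (dx dy : R →+ R)
    (hx : ∀ f g : R, dx (f * g) = dx f * g + f * dx g)
    (hy : ∀ f g : R, dy (f * g) = dy f * g + f * dy g)
    (Ψ χ y d : R) (hxy : dx y = 0) (hyy : dy y = 1) (hxd : dx d = 0) (hyd : dy d = 0) :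
    pbracket dx dy (Ψ + d * (χ - y)) (lapl dx dy (Ψ + d * (χ - y)))
      = pbracket dx dy Ψ (lapl dx dy Ψ)
        + d * (meanOp dx dy Ψ χ + dx (lapl dx dy Ψ))
        + d * d * (pbracket dx dy χ (lapl dx dy χ) + dx (lapl dx dy χ)) := by
  have h1y : dy 1 = 0 := leibniz_map_one dy hy
  simp only [pbracket, lapl, meanOp, map_add, map_sub, hx, hy, hxy, hyy, hxd, hyd, h1y,
    zero_mul, zero_add, sub_zero]
  ring

/-- CONSEQUENCE (paper §24.75 (2)–(3)): if the carrier solves the forced Euler equation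
`{Ψ, ΔΨ} = G` and `χ` solves the mean-flow equation `L χ = −∂ₓ ΔΨ`, then the family
`Ψ + d (χ − y)` — mean flow shifted by `d`, cellular part corrected by `d χ` — has the SAME force
up to an exactly quadratic remainder `d² ({χ, Δχ} + ∂ₓ Δχ)`. -/
theorem meanFlowFamily_forceDefect_of_solution (dx dy : R →+ R)
    (hx : ∀ f g : R, dx (f * g) = dx f * g + f * dx g)
    (hy : ∀ f g : R, dy (f * g) = dy f * g + f * dy g)
    (Ψ χ y d G : R) (hxy : dx y = 0) (hyy : dy y = 1) (hxd : dx d = 0) (hyd : dy d = 0)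
    (hΨ : pbracket dx dy Ψ (lapl dx dy Ψ) = G)
    (hχ : meanOp dx dy Ψ χ = -dx (lapl dx dy Ψ)) :
    pbracket dx dy (Ψ + d * (χ - y)) (lapl dx dy (Ψ + d * (χ - y))) - G
      = d * d * (pbracket dx dy χ (lapl dx dy χ) + dx (lapl dx dy χ)) := by
  rw [meanFlowFamily_forceDefect dx dy hx hy Ψ χ y d hxy hyy hxd hyd, hχ, ← hΨ]
  ring

/-- Conversely, the first-order term vanishes ONLY IF `χ` solves the mean-flow equation, provided
`d` is not a zero divisor: the fixed-force condition at order `d` is exactly `L χ = −∂ₓ ΔΨ`. -/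
theorem meanFlowEquation_of_firstOrder (dx dy : R →+ R) (Ψ χ d : R)
    (hd : ∀ a : R, d * a = 0 → a = 0)
    (h : d * (meanOp dx dy Ψ χ + dx (lapl dx dy Ψ)) = 0) :
    meanOp dx dy Ψ χ = -dx (lapl dx dy Ψ) := by
  have := hd _ h
  linear_combination this

end Summit.AnomalousDissipation.AnomalousDissipation.Theorems
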